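import Literature.Analysis.FluidPDE.Seregin2020ScaledEnergyBoundsA
import Literature.Analysis.FluidPDE.LocalTypeI
import HarnessLib

/-!
# Chen–Tsai–Zhang 2022, §3: the local energy estimates `A + E ≤ N(1 + C + D)` (Lemma 3.1) and
# the pressure decay `D(ρ) ≤ N (ρ/R) D(R) + N (R/ρ)² C(R)` (Lemma 3.4)

Analysis/FluidPDE proof file (everything PROVED; no definitions, no named facts), companion of
`ChenTsaiZhang2022LocalRegularity.lean` (the §1 criteria of the same paper).

H. Chen, T.-P. Tsai, T. Zhang, *Remarks on local regularity of axisymmetric solutions to the 3D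
Navier–Stokes equations*, Comm. Partial Differential Equations 47 (2022) = arXiv:2201.01766, §3
"Local energy estimates", p. 10 of the arXiv version (render `paper-arxiv-2201.01766/p0010.txt`
L1–22 (Lemma 3.1) and L70–76 (Lemma 3.4); line numbers are render-dependent, page and lemma
numbers exact), in the notation (AE.def) of §1 (p. 3, L44–49):
`A(z₀,R) = sup_{t₀-R²<t<t₀} R⁻¹ ∫_{B(x₀,R)} |u(x,t)|² dx`, `E(z₀,R) = R⁻¹ ∬_{Q(z₀,R)} |∇u|²`,
`C(z₀,R) = R⁻² ∬_{Q(z₀,R)} |u|³`, `D(z₀,R) = R⁻² ∬_{Q(z₀,R)} |Π|^{3/2}`,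
`Q(z₀,R) = B(x₀,R) × (t₀-R², t₀)`, for a suitable weak solution `(u, Π)` of Navier–Stokes
(`ν = 1`, no force) in `Q(1) = Q(0,1)` (Def. 1.1: `u ∈ L^∞(-1,0;L²) ∩ L²(-1,0;H¹)`, `Π ∈ L^{3/2}`,
the equations in the sense of distributions, the local energy inequality).

> **Lemma 3.1.** For `z₀ = (x₀,t₀) ∈ Q(1/8)` and `0 < ρ ≤ 1/4`, we have
> `A(z₀,ρ) + E(z₀,ρ) ≤ N (1 + C(z₀,2ρ) + D(z₀,2ρ))`.
>
> *Proof.* By choosing a suitable test function `φ` in the local energy inequality, we get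
> `A(z₀,ρ) + E(z₀,ρ) ≤ N (C(z₀,2ρ)^{2/3} + C(z₀,2ρ) + ρ⁻² ‖u‖_{L³(Q(z₀,2ρ))} ‖Π‖_{L^{3/2}(Q(z₀,2ρ))})`
> `≤ N (C(z₀,2ρ)^{2/3} + C(z₀,2ρ) + C(z₀,2ρ)^{1/3} D(z₀,2ρ)^{2/3}) ≤ N (1 + C(z₀,2ρ) + D(z₀,2ρ))`.
>
> **Lemma 3.4** ([Gustafson–Kang–Tsai 2007]). For `0 < 2ρ ≤ R ≤ 1/4`, we have
> `D(z₀,ρ) ≤ N (ρ/R) D(z₀,R) + N (R/ρ)² C(z₀,R)`.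

(`N` denotes a general absolute constant.)

## What is proved, and how

The first display of the printed proof of Lemma 3.1 — the local energy bound on a cylinder
`Q(z₀,2ρ)` that may touch the top of the domain — is the tree theorem
`Seregin2020.localEnergyBound_top` (`Seregin2020ScaledEnergyBounds.lean`; Lemarié-Rieusset 2016
p. 506 + Tsai 1998's exhaustion), the second display is Young's inequality
`D^{2/3} C^{1/3} ≤ D + C` (`Seregin2020.rpow_two_thirds_mul_rpow_one_third_le` with `s = 1`),
and the third is `C^{2/3} ≤ 1 + C`.  We prove:

* `ChenTsaiZhang2022.cknAEss_add_cknE_le` — **Lemma 3.1 on a general domain**: one absolute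
  `N` such that for every suitable weak solution `(u, p)` (`ν = 1`, `f = 0`) on an open
  `Q ⊆ ℝ × ℝ³`, every weak spatial gradient `G` of `u` on `Q` and every backward cylinder with
  `Q(z₀, 2ρ) ⊆ Q`, `A(z₀,ρ) + E(z₀,ρ) ≤ N (1 + C(z₀,2ρ) + D(z₀,2ρ))`;
  `…_of_le` — the gauge form `≤ N (1 + 2M)` when `C(z₀,2ρ), D(z₀,2ρ) ≤ M`
  (the form used in the cell memo nsreg-p2 ROUND-18 §1c(i), "`E ≤ N(1+2M)` (CTZ22 L3.1)");
* `ChenTsaiZhang2022.lemma_3_1` — **Lemma 3.1 as printed**, in `Q(1)` with `z₀ ∈ Q(1/8)`,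
  `0 < ρ ≤ 1/4` (then `Q(z₀,2ρ) ⊆ Q(1)`);
  `ChenTsaiZhang2022.lemma_3_1_inBall` — the same over the Albritton–Barker packaging
  `IsSuitableWeakSolutionInBall 1 0 u p` of Def. 1.1 in `Q(1)` (the class of the §1 facts of
  `ChenTsaiZhang2022LocalRegularity.lean`), which carries its own weak gradient;
* `ChenTsaiZhang2022.lemma_3_4` — **Lemma 3.4 as printed** (and `cknD_decay`, the general-domain
  form with `0 < ρ ≤ R`, `Q(z₀,R) ⊆ Q`), from the tree's DISCHARGED pressure-decay fact
  `seregin_sverak_pressure_decay` / `seregin_sverak_pressure_decay_holds`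
  (`PressureDecayEstimate(Proofs).lean`; Seregin–Šverák 2009 (as13) = Gustafson–Kang–Tsai 2007's
  estimate).

## Rendering

The tree's scaled quantities `cknAEss`, `cknE`, `cknC`, `cknD` (`SuitableWeak.lean`,
`LocalTypeI.lean`) ARE CTZ's `A, E, C, D` at `ν = 1`, points written time first `z = (t, x)`,
`Q(z₀,R) = parabolicCylinder R z₀`.  CTZ's `A` is a supremum over `t` of the slice energies of an
`L^∞(L²)` class, i.e. an essential supremum for the a.e.-defined field: it is rendered by `cknAEss`
(the local energy inequality bounds the slice energies for a.e. `t` only; the genuine-`sup`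
variant `cknA ≥ cknAEss` of an arbitrary representative cannot be bounded).  `E` is written with a
weak spatial gradient `G` of `u` (any two agree a.e., so `cknE` does not depend on the choice).
"Suitable weak solution in `Q(1)`" = `IsSuitableWeakSolutionOn (parabolicCylinderOpens 1 0) 1 0 u p`
(the accepted local CKN/Lin class: distributional solution, `L^∞L²` and `L^{3/2}` locally, local
energy inequality) — WEAKER than Def. 1.1, which asks the global classes on `Q(1)`; the printed
Def. 1.1 verbatim is `IsSuitableWeakSolutionInBall 1 0 u p` (`lemma_3_1_inBall`).  Lemma 3.4 needs
only the distributional equations (`IsDistributionalNSSolutionOn`), as in the tree fact.  The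
constants `N` are absolute (they come out of `localEnergyBound_top` and the pressure-decay fact at
`ν = 1`).  Nothing here is specific to axial symmetry (§3's standing assumption is not used by
Lemmas 3.1 and 3.4, exactly as in print).  Lemmas 3.2–3.3 (the with-swirl interpolation bounds on
`C` through `b ∈ L^{p,q}` / `Ḃ⁻¹_{∞,∞}` and Lemma 2.1's `Γ`-bound) are NOT rendered here.

## Mathlib / tree search

`lean search 'localEnergyBound|cknAEss.*cknE|pressure_decay'`: `Seregin2020.localEnergyBound_top`,
`localEnergyBound` (`CKNLocalEnergyBound.lean`, cylinders with closure inside `Q`, free ratio `θ`),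
`seregin_sverak_pressure_decay(_holds)`; no statement of the `N(1 + C + D)` form and no decl keyed
to CTZ22 §3 (2026-08-27).  WHAT THIS IS NOT: not a regularity statement; two bookkeeping
inequalities between the CKN scaled quantities of a suitable weak solution, kernel-derived from
tree theorems.

## References

* H. Chen, T.-P. Tsai, T. Zhang, Comm. PDE 47 (2022) = arXiv:2201.01766, §1 Def. 1.1 and
  (AE.def) (p. 3), §3 Lemma 3.1 and Lemma 3.4 (p. 10). [`ChenTsaiZhang2022`]
* S. Gustafson, K. Kang, T.-P. Tsai, Comm. Math. Phys. 273 (2007) (the pressure decay estimate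
  cited by Lemma 3.4). [`GustafsonKangTsai2007`]
* G. Seregin, V. Šverák, Comm. PDE 34 (2009) = arXiv:0804.1803, proof of Lemma 3.5, (as13).
  [`SereginSverak2009`]
* P. G. Lemarié-Rieusset, *The Navier–Stokes Problem in the 21st Century*, §14.3 p. 506 (the
  local energy bound behind `localEnergyBound_top`). [`Lemarierieusset2023`]
-/

noncomputable section

open MeasureTheory Set Function Filter Topology TopologicalSpace Metric
open scoped NNReal ENNReal

namespace Literature.Analysis.FluidPDE

namespace ChenTsaiZhang2022

/-! ### Two elementary inequalities in `ℝ≥0∞` -/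

/-- `x^{2/3} ≤ 1 + x` in `ℝ≥0∞` (split at `x = 1`). [folklore] -/
private theorem rpow_two_thirds_le_one_add (x : ℝ≥0∞) : x ^ (2 / 3 : ℝ) ≤ 1 + x := by
  rcases le_or_gt x 1 with hx | hx
  · exact (ENNReal.rpow_le_one hx (by norm_num)).trans le_self_add
  · calc x ^ (2 / 3 : ℝ) ≤ x ^ (1 : ℝ) :=
          ENNReal.rpow_le_rpow_of_exponent_le hx.le (by norm_num)
      _ = x := ENNReal.rpow_one x
      _ ≤ 1 + x := le_add_self

/-- Young: `D^{2/3} C^{1/3} ≤ D + C` in `ℝ≥0∞`. [folklore] -/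
private theorem rpow_two_thirds_mul_rpow_one_third_le_add (D C : ℝ≥0∞) :
    D ^ (2 / 3 : ℝ) * C ^ (1 / 3 : ℝ) ≤ D + C := by
  simpa using Seregin2020.rpow_two_thirds_mul_rpow_one_third_le D C one_ne_zero ENNReal.one_ne_top

/-- The cylinders `Q(z₀, R)`, `R ≤ 1/2`, about a point `z₀ ∈ Q(1/8) = Q(0, 1/8)` lie in
`Q(1) = Q(0, 1)` (triangle inequality; `-1/64 - 1/4 > -1`). [folklore] -/
private theorem parabolicCylinder_subset_one {z₀ : ℝ × EuclideanSpace ℝ (Fin 3)}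
    (hz₀ : z₀ ∈ parabolicCylinder (1 / 8) (0 : ℝ × EuclideanSpace ℝ (Fin 3))) {R : ℝ}
    (hR : R ≤ 1 / 2) :
    parabolicCylinder R z₀ ⊆ parabolicCylinder 1 (0 : ℝ × EuclideanSpace ℝ (Fin 3)) := by
  intro w hw
  rw [mem_parabolicCylinder] at hz₀ hw ⊢
  simp only [Prod.fst_zero, Prod.snd_zero, zero_sub] at hz₀ ⊢
  obtain ⟨⟨hz1, hz2⟩, hz3⟩ := hz₀
  obtain ⟨⟨hw1, hw2⟩, hw3⟩ := hw
  have hR0 : 0 < R := lt_of_le_of_lt dist_nonneg hw3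
  have hR2 : R ^ 2 ≤ 1 / 4 := by nlinarith
  refine ⟨⟨by nlinarith, by linarith⟩, ?_⟩
  calc dist w.2 0 ≤ dist w.2 z₀.2 + dist z₀.2 0 := dist_triangle _ _ _
    _ < R + 1 / 8 := by linarith
    _ ≤ 1 := by linarith

/-! ### Lemma 3.1: `A + E ≤ N (1 + C + D)` -/

/-- **Chen–Tsai–Zhang 2022, Lemma 3.1, on a general domain.** There is an absolute constant `N`
such that for every suitable weak solution `(u, p)` of the unforced Navier–Stokes equations
(`ν = 1`) on an open `Q ⊆ ℝ × ℝ³`, every weak spatial gradient `G` of `u` on `Q`, every point `z₀`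
and every `ρ > 0` with `Q(z₀, 2ρ) ⊆ Q` (the cylinder may touch the top of `Q`),
`A(z₀,ρ) + E(z₀,ρ) ≤ N (1 + C(z₀,2ρ) + D(z₀,2ρ))` (`A = cknAEss`, `E = cknE`, `C = cknC`,
`D = cknD`).  Proof as printed (p. 10): the local energy bound
`A(ρ) + E(ρ) ≤ N (C(2ρ)^{2/3} + C(2ρ) + C(2ρ)^{1/3} D(2ρ)^{2/3})` (tree:
`Seregin2020.localEnergyBound_top`), then `C^{2/3} ≤ 1 + C` and Young `D^{2/3}C^{1/3} ≤ D + C`.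
[cite: ChenTsaiZhang2022, Lemma 3.1 and its proof (arXiv:2201.01766 p. 10)] -/
theorem cknAEss_add_cknE_le :
    ∃ N : ℝ≥0, ∀ (Q : Opens (ℝ × EuclideanSpace ℝ (Fin 3)))
      (u : ℝ → EuclideanSpace ℝ (Fin 3) → EuclideanSpace ℝ (Fin 3))
      (p : ℝ → EuclideanSpace ℝ (Fin 3) → ℝ)
      (G : ℝ → EuclideanSpace ℝ (Fin 3) → EuclideanSpace ℝ (Fin 3) →L[ℝ] EuclideanSpace ℝ (Fin 3)),
      IsSuitableWeakSolutionOn Q 1 0 u p → HasWeakSpatialGradientOn Q u G →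
      ∀ (z₀ : ℝ × EuclideanSpace ℝ (Fin 3)) (ρ : ℝ), 0 < ρ →
        parabolicCylinder (2 * ρ) z₀ ⊆ (Q : Set (ℝ × EuclideanSpace ℝ (Fin 3))) →
        cknAEss ρ z₀ u + cknE ρ z₀ G ≤
          N * (1 + cknC (2 * ρ) z₀ u + cknD (2 * ρ) z₀ p) := by
  obtain ⟨c₁, c₂, c₃, H⟩ := Seregin2020.localEnergyBound_top
  refine ⟨c₁ + c₂ + c₃, fun Q u p G hsw hG z₀ ρ hρ hQ => ?_⟩
  have h2ρ : 0 < 2 * ρ := by positivity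
  have key := H Q u p G hsw hG z₀ (2 * ρ) h2ρ hQ
  rw [show 2 * ρ / 2 = ρ by ring] at key
  set C := cknC (2 * ρ) z₀ u with hC
  set D := cknD (2 * ρ) z₀ p with hD
  calc cknAEss ρ z₀ u + cknE ρ z₀ G
      ≤ c₁ * C ^ (2 / 3 : ℝ) + c₂ * C + c₃ * (D ^ (2 / 3 : ℝ) * C ^ (1 / 3 : ℝ)) := key
    _ ≤ c₁ * (1 + C) + c₂ * C + c₃ * (D + C) :=
        add_le_add (add_le_add (mul_le_mul' le_rfl (rpow_two_thirds_le_one_add C)) le_rfl)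
          (mul_le_mul' le_rfl (rpow_two_thirds_mul_rpow_one_third_le_add D C))
    _ = (c₁ + c₁ * C + c₂ * C + c₃ * D + c₃ * C) := by ring
    _ ≤ (c₁ + c₁ * C + c₂ * C + c₃ * D + c₃ * C) + (c₁ * D + c₂ + c₂ * D + c₃) := le_self_add
    _ = ((c₁ + c₂ + c₃ : ℝ≥0) : ℝ≥0∞) * (1 + C + D) := by
        push_cast
        ring

/-- **Lemma 3.1 in gauge form**: with the constant `N` of `cknAEss_add_cknE_le`, if
`C(z₀,2ρ) ≤ M` and `D(z₀,2ρ) ≤ M` then `A(z₀,ρ) + E(z₀,ρ) ≤ N (1 + 2M)` — the form in which the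
estimate is quoted for a solution whose scaled quantities `C, D` are bounded by `M` at the point and
scale in question ("`E ≤ N(1+2M)` (CTZ22 L3.1)").
[cite: ChenTsaiZhang2022, Lemma 3.1 (arXiv:2201.01766 p. 10)] -/
theorem cknAEss_add_cknE_le_of_le :
    ∃ N : ℝ≥0, ∀ (Q : Opens (ℝ × EuclideanSpace ℝ (Fin 3)))
      (u : ℝ → EuclideanSpace ℝ (Fin 3) → EuclideanSpace ℝ (Fin 3))
      (p : ℝ → EuclideanSpace ℝ (Fin 3) → ℝ)
      (G : ℝ → EuclideanSpace ℝ (Fin 3) → EuclideanSpace ℝ (Fin 3) →L[ℝ] EuclideanSpace ℝ (Fin 3)),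
      IsSuitableWeakSolutionOn Q 1 0 u p → HasWeakSpatialGradientOn Q u G →
      ∀ (z₀ : ℝ × EuclideanSpace ℝ (Fin 3)) (ρ : ℝ), 0 < ρ →
        parabolicCylinder (2 * ρ) z₀ ⊆ (Q : Set (ℝ × EuclideanSpace ℝ (Fin 3))) →
        ∀ M : ℝ≥0∞, cknC (2 * ρ) z₀ u ≤ M → cknD (2 * ρ) z₀ p ≤ M →
          cknAEss ρ z₀ u + cknE ρ z₀ G ≤ N * (1 + 2 * M) := by
  obtain ⟨N, H⟩ := cknAEss_add_cknE_le
  refine ⟨N, fun Q u p G hsw hG z₀ ρ hρ hQ M hCM hDM => (H Q u p G hsw hG z₀ ρ hρ hQ).trans ?_⟩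
  refine mul_le_mul' le_rfl ?_
  calc 1 + cknC (2 * ρ) z₀ u + cknD (2 * ρ) z₀ p ≤ 1 + M + M :=
        add_le_add (add_le_add le_rfl hCM) hDM
    _ = 1 + 2 * M := by ring

/-- **Chen–Tsai–Zhang 2022, Lemma 3.1 (as printed).** "For `z₀ = (x₀,t₀) ∈ Q(1/8)` and
`0 < ρ ≤ 1/4`, we have `A(z₀,ρ) + E(z₀,ρ) ≤ N (1 + C(z₀,2ρ) + D(z₀,2ρ))`" — for a suitable weak
solution `(u, p)` of Navier–Stokes (`ν = 1`, no force) in `Q(1) = Q(0,1)` (here: the local CKN/Lin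
class on the open cylinder `Q(1)`, weaker than Def. 1.1) and a weak spatial gradient `G` of `u` on
`Q(1)` (`A = cknAEss`, `E = cknE` of `G`, `C = cknC`, `D = cknD`; `N` absolute).  From
`cknAEss_add_cknE_le`, since `Q(z₀, 2ρ) ⊆ Q(1)`.
[cite: ChenTsaiZhang2022, Lemma 3.1 (arXiv:2201.01766 p. 10)] -/
theorem lemma_3_1 :
    ∃ N : ℝ≥0, ∀ (u : ℝ → EuclideanSpace ℝ (Fin 3) → EuclideanSpace ℝ (Fin 3))
      (p : ℝ → EuclideanSpace ℝ (Fin 3) → ℝ)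
      (G : ℝ → EuclideanSpace ℝ (Fin 3) → EuclideanSpace ℝ (Fin 3) →L[ℝ] EuclideanSpace ℝ (Fin 3)),
      IsSuitableWeakSolutionOn
          (parabolicCylinderOpens 1 (0 : ℝ × EuclideanSpace ℝ (Fin 3))) 1 0 u p →
      HasWeakSpatialGradientOn
          (parabolicCylinderOpens 1 (0 : ℝ × EuclideanSpace ℝ (Fin 3))) u G →
      ∀ z₀ ∈ parabolicCylinder (1 / 8) (0 : ℝ × EuclideanSpace ℝ (Fin 3)), ∀ ρ : ℝ,
        0 < ρ → ρ ≤ 1 / 4 →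
        cknAEss ρ z₀ u + cknE ρ z₀ G ≤
          N * (1 + cknC (2 * ρ) z₀ u + cknD (2 * ρ) z₀ p) := by
  obtain ⟨N, H⟩ := cknAEss_add_cknE_le
  refine ⟨N, fun u p G hsw hG z₀ hz₀ ρ hρ hρ4 => H _ u p G hsw hG z₀ ρ hρ ?_⟩
  rw [coe_parabolicCylinderOpens]
  exact parabolicCylinder_subset_one hz₀ (by linarith)

/-- **Lemma 3.1 over the printed class Def. 1.1 in `Q(1)`** (`IsSuitableWeakSolutionInBall 1 0 u p`,
the Albritton–Barker packaging used by the §1 facts of `ChenTsaiZhang2022LocalRegularity.lean`):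
such a solution carries a weak spatial gradient `G` on `Q(1)` (with `∇u ∈ L²(Q(1))`), and for it
`A(z₀,ρ) + E(z₀,ρ) ≤ N (1 + C(z₀,2ρ) + D(z₀,2ρ))` for all `z₀ ∈ Q(1/8)`, `0 < ρ ≤ 1/4`, with the
absolute `N` of `lemma_3_1`.
[cite: ChenTsaiZhang2022, Def. 1.1 (p. 3) and Lemma 3.1 (arXiv:2201.01766 p. 10)] -/
theorem lemma_3_1_inBall :
    ∃ N : ℝ≥0, ∀ (u : ℝ → EuclideanSpace ℝ (Fin 3) → EuclideanSpace ℝ (Fin 3))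
      (p : ℝ → EuclideanSpace ℝ (Fin 3) → ℝ),
      IsSuitableWeakSolutionInBall 1 0 u p →
      ∃ G : ℝ → EuclideanSpace ℝ (Fin 3) → EuclideanSpace ℝ (Fin 3) →L[ℝ] EuclideanSpace ℝ (Fin 3),
        HasWeakSpatialGradientOn
            (parabolicCylinderOpens 1 (0 : ℝ × EuclideanSpace ℝ (Fin 3))) u G ∧
        ∫⁻ w in parabolicCylinder 1 (0 : ℝ × EuclideanSpace ℝ (Fin 3)),
            ENNReal.ofReal (frobeniusNormSq (G w.1 w.2)) < ∞ ∧
        ∀ z₀ ∈ parabolicCylinder (1 / 8) (0 : ℝ × EuclideanSpace ℝ (Fin 3)), ∀ ρ : ℝ,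
          0 < ρ → ρ ≤ 1 / 4 →
          cknAEss ρ z₀ u + cknE ρ z₀ G ≤
            N * (1 + cknC (2 * ρ) z₀ u + cknD (2 * ρ) z₀ p) := by
  obtain ⟨N, H⟩ := lemma_3_1
  refine ⟨N, fun u p hsw => ?_⟩
  obtain ⟨hsol, -, ⟨G, hG, hGint⟩, -⟩ := hsw
  exact ⟨G, hG, hGint, fun z₀ hz₀ ρ hρ hρ4 => H u p G hsol hG z₀ hz₀ ρ hρ hρ4⟩

/-! ### Lemma 3.4: the pressure decay estimate -/

/-- **Chen–Tsai–Zhang 2022, Lemma 3.4, on a general domain** (the pressure decay estimate of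
Gustafson–Kang–Tsai 2007 / Seregin–Šverák 2009 (as13)): there is an absolute `N` such that for
every distributional solution `(u, p)` of the unforced unit-viscosity Navier–Stokes equations on an
open `Q ⊆ ℝ × ℝ³`, every cylinder `Q(z₀, R) ⊆ Q` and every `0 < ρ ≤ R`,
`D(z₀,ρ) ≤ N (ρ/R) D(z₀,R) + N (R/ρ)² C(z₀,R)`.  This is the tree's discharged fact
`seregin_sverak_pressure_decay` (`_holds`), with the constant distributed over the sum.
[cite: ChenTsaiZhang2022, Lemma 3.4 (arXiv:2201.01766 p. 10); SereginSverak2009 proof of Lemma 3.5 (as13)] -/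
theorem cknD_decay :
    ∃ N : ℝ≥0, ∀ (Q : Opens (ℝ × EuclideanSpace ℝ (Fin 3)))
      (u : ℝ → EuclideanSpace ℝ (Fin 3) → EuclideanSpace ℝ (Fin 3))
      (p : ℝ → EuclideanSpace ℝ (Fin 3) → ℝ),
      IsDistributionalNSSolutionOn Q 1 0 u p →
      ∀ (z₀ : ℝ × EuclideanSpace ℝ (Fin 3)) (ρ R : ℝ), 0 < ρ → ρ ≤ R →
        parabolicCylinder R z₀ ⊆ (Q : Set (ℝ × EuclideanSpace ℝ (Fin 3))) →
        cknD ρ z₀ p ≤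
          N * ENNReal.ofReal (ρ / R) * cknD R z₀ p +
            N * ENNReal.ofReal ((R / ρ) ^ 2) * cknC R z₀ u := by
  obtain ⟨c, hc⟩ := seregin_sverak_pressure_decay_holds
  refine ⟨c, fun Q u p hsol z₀ ρ R hρ hρR hQ => ?_⟩
  have key := hc Q u p hsol z₀ R ρ hρ hρR hQ
  calc cknD ρ z₀ p
      ≤ c * (ENNReal.ofReal (ρ / R) * cknD R z₀ p + ENNReal.ofReal ((R / ρ) ^ 2) * cknC R z₀ u) :=
        key
    _ = c * ENNReal.ofReal (ρ / R) * cknD R z₀ p +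
          c * ENNReal.ofReal ((R / ρ) ^ 2) * cknC R z₀ u := by ring

/-- **Chen–Tsai–Zhang 2022, Lemma 3.4 (as printed)** ("[Gustafson–Kang–Tsai 2007]. For
`0 < 2ρ ≤ R ≤ 1/4`, we have `D(z₀,ρ) ≤ N (ρ/R) D(z₀,R) + N (R/ρ)² C(z₀,R)`"), for a suitable weak
solution `(u, p)` of Navier–Stokes (`ν = 1`, no force) in `Q(1)` and `z₀ ∈ Q(1/8)` (the standing
point of §3; then `Q(z₀,R) ⊆ Q(1)`).  From `cknD_decay`; only the distributional equations of the
suitable class are used, and the printed restriction `2ρ ≤ R` is relaxed to `ρ ≤ R`.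
[cite: ChenTsaiZhang2022, Lemma 3.4 (arXiv:2201.01766 p. 10); GustafsonKangTsai2007] -/
theorem lemma_3_4 :
    ∃ N : ℝ≥0, ∀ (u : ℝ → EuclideanSpace ℝ (Fin 3) → EuclideanSpace ℝ (Fin 3))
      (p : ℝ → EuclideanSpace ℝ (Fin 3) → ℝ),
      IsSuitableWeakSolutionOn
          (parabolicCylinderOpens 1 (0 : ℝ × EuclideanSpace ℝ (Fin 3))) 1 0 u p →
      ∀ z₀ ∈ parabolicCylinder (1 / 8) (0 : ℝ × EuclideanSpace ℝ (Fin 3)), ∀ ρ R : ℝ,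
        0 < ρ → ρ ≤ R → R ≤ 1 / 4 →
        cknD ρ z₀ p ≤
          N * ENNReal.ofReal (ρ / R) * cknD R z₀ p +
            N * ENNReal.ofReal ((R / ρ) ^ 2) * cknC R z₀ u := by
  obtain ⟨N, H⟩ := cknD_decay
  refine ⟨N, fun u p hsw z₀ hz₀ ρ R hρ hρR hR4 => H _ u p hsw.distributional z₀ ρ R hρ hρR ?_⟩
  rw [coe_parabolicCylinderOpens]
  exact parabolicCylinder_subset_one hz₀ (by linarith)

end ChenTsaiZhang2022

end Literature.Analysis.FluidPDE
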